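import Summits.QuantumFields.BalabanUV.Beta.D1BFx.ReducedTableF
import Summits.QuantumFields.BalabanUV.Beta.D1BFx.MomentTransferParity

/-!
# `BalabanUV.Beta.D1BFx.DressedTablesLeg` — road «BF-x» for binder row D1, sub-leaf A4-leg (part 1): THE FINE BUBBLE AND TADPOLE
# TABLES OVER A GENERIC LEG `A : MKer 4 F` AND THEIR `ℋ`-SANDWICH BRIDGES — the ghost-capable twin of leaf A4's `DressedBubbleTable` /
# `DressedTadpoleTable` (which are typed for the gluon leg `Ga n a` at the fibre `Fin 4` only)

HONEST DEPENDENCY (page 1, mandatory): continuum YM on T⁴ ⇐ BetaPertH ∧ nine spine estimates (0/9 proved); BetaPertH ⇐ (D1) ∧ (D4) ∧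
CAP+tail; G-an2-4 gates asym, D1 and NE2/3/4.  HONEST FRAMING (cell contract, verbatim): «discharging `BetaPertH` makes Bałaban's UV
stability UNCONDITIONAL — a real constructive-QFT result; it is NOT the continuum limit and NOT the Clay problem.»  THIS FILE DISCHARGES
NOTHING of the wall: two definitions with bodies ([our object] `bubbleTableA`, `tadpoleTableA`) and [folklore] Fubini / re-indexing
bookkeeping of absolutely convergent lattice sums, composed BY NAME from leaf A4 part 1 (`DressedBubbleBridge`, generic exchanges), part 3
(`DressedTadpoleTable.biLoc_wsum_snd/_fst`, `tadpole_wsum_wsum`), the typer's T8-tab (`ReducedTableF.tableRedF`) and K-R5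
(`MomentTransferPeriodic*`, leg-free).  No `def … : Prop`, no citation, no hypothesis is a printed statement; 0 binders of the hR root
touched.
ABSOLUTE RULE (cell charter, verbatim): «No internally-minted statement may enter as a cited fact. Every hypothesis is either
kernel-proved in this package or a verbatim quotation of a PUBLISHED theorem with page reference. The manuscript(s) under audit are NOT
citable for their own disputed steps — they are the thing under adjudication; programme-internal (2001/route/tribunal) claims are never
citable.»

WHY (skeleton `HOME/beta/skeletons/D1-b2b-balaban-beta-d1-p2.md` v1.4 node R5, verbatim: «for `P ∈ {Pgl n, Pgh n}`, `secondMoment (ℋ_nᵀ P ℋ_n) μ ν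
= ν(n) · Avg_{b ∈ block} fullSum (w ↦ w_μ w_ν P(b, b+w)) + X_n(P)`»).  Leaf A4 (leaf-01 gen 1: `DressedBubbleTable` p209745, `DressedTadpoleTable`
p210026, `ReducedKernelSandwich` p210294, `MomentTransferParity` p210549) proved `X_n = 0` for the GLUON reduced kernel `TOfRed n a S (tableRed n Wf)`
(leg `Ga n a`, fibre `Fin 4`).  The GHOST fine kernel of leaf-04's T7-gh (`Pgh := TOfGh n a (Sgh …) (…)`, leg `GhostLeg.Ggh n a`, fibre
`Unit`) needs the same transfer.  The only properties of `Ga n a` the A4 chain used are `Spr (Ga n a)` and block covariance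
`shiftK (−n•t) (Ga n a) = Ga n a`; this file and its sequel `ReducedKernelSandwichLeg` re-run the chain ONCE for an arbitrary leg
`A : MKer 4 F` (`[Fintype F] [Nonempty F]`) under exactly those two hypotheses, with the typer's generic-fibre table slot `tableRedF`
(p210460) — whose summation order `Σ_{κ′} Σ_{λ′} Σ′_u Σ′_{u′}` needs no finite-sum / series exchange.

CONTENT.
* §1 [our object] `bubbleTableA A S κ′ λ′ u u′ := −½ · bubble A (S κ′ u) (S λ′ u′)`; [folklore] `isBlockPeriodic_bubbleTableA`, `bubble_comm`
  (generic `D`, `F`; trace cyclicity), `bubbleTableA_transpose`, `exists_decay_bubbleTableA`, `absMoment₂_baseKer_bubbleTableA`.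
* §2 [folklore] `vertexRedF_eq_sum_wsum`, `loc_wsum_wH`, **`bubble_vertexRedF`**, **`bubblePartA_eq_dressedEntryP`**
  (`−½·bubble A (vertexRedF S μ 0) (vertexRedF S ν z) = dressedEntryP (wK n) (bubbleTableA A S) (n•(−z)) μ ν`).
* §3 [our object] `tadpoleTableA A Wf κ′ λ′ u u′ := ½ · tadpole A (Wf κ′ u λ′ u′)`; [folklore] periodicity, decay, summability,
  `tableRedF_eq_sum_wsum`, **`tadpole_tableRedF`** (the `ℋ ⊗ ℋ` exchange for the typer's table), **`tadpolePartA_eq_dressedEntryP`**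
  (`½·tadpole A (tableRedF n Wf μ 0 ν z) = dressedEntryP (wK n) (tadpoleTableA A Wf) (n•(−z)) μ ν`).
At `A := Ga n a` the two tables ARE leaf A4's `bubbleTable n a` / `tadpoleTable n a` (`rfl`, recorded in the sequel).  NOT HERE: which
stencils/tables are Bałaban's, any Ward row or parity (hypotheses downstream), any estimate uniform in `n`.  Unit
`b2b-balaban-beta-d1-formalise-leaf-01` (gen 2).
-/

noncomputable section

namespace Summit.QuantumFields.BalabanUV.Beta.D1BFx.DressedTablesLeg

open Finset
open scoped BigOperators
open Literature.MathematicalPhysics.QuantumFieldTheory.Balaban1983to89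
open Literature.MathematicalPhysics.QuantumFieldTheory.Balaban1983to89.Beta
open B12Sec2to5 (l1 l1_nonneg Decay510)
open ExpKernelCalculus (Site MKer Decays BiLoc comp tr bubble tadpole shiftK bubble_shiftK tadpole_shiftK Zl Zl_nonneg
  biLoc_comp_decays biLoc_comp_biLoc abs_tr_le l1_sub_triangle l1_sub_symm)
open DecimatedMoment (cosetInd)
open DecimatedMomentSummable (AbsMoment₂ absMoment₂_of_decay510)
open DressedMomentNormalisation (EKer resSite)
open KernelSpecInstance (wH)
open MinimiserIdentityForm (wK)
open OneStepResolventKernel (wsum)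
open Summit.QuantumFields.BalabanUV.Beta.TameKernelCalculus
open Summit.QuantumFields.BalabanUV.Beta.KernelWardRelative (loc_finset_sum tadpole_finset_sum bubble_finset_sum_left)
open Summit.QuantumFields.BalabanUV.Beta.D1BFx.ReducedKernelF (vertexRedF)
open Summit.QuantumFields.BalabanUV.Beta.D1BFx.ReducedTableF (tableRedF)
open Summit.QuantumFields.BalabanUV.Beta.D1BFx.DressedBubbleBridge
open Summit.QuantumFields.BalabanUV.Beta.D1BFx.DressedBubbleTable (exists_expWeight_wH)
open Summit.QuantumFields.BalabanUV.Beta.D1BFx.DressedTadpoleTable (biLoc_wsum_snd biLoc_wsum_fst abs_tsum_wmul_le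
  exists_tadpole_bound tadpole_wsum_wsum)
open Summit.QuantumFields.BalabanUV.Beta.D1BFx.MomentTransferPeriodic (Ker₂ IsBlockPeriodic baseKer)
open Summit.QuantumFields.BalabanUV.Beta.D1BFx.MomentTransferPeriodicSum (dressedSumP)
open Summit.QuantumFields.BalabanUV.Beta.D1BFx.MomentTransferPeriodicEntry (EKer₂ dressedEntryP)

variable {F : Type*} [Fintype F]

/-! ## §1 The fine bubble table over a generic leg -/

/-- [our object] **THE FINE BUBBLE TABLE OVER THE LEG `A`** of a first-order fine stencil family `S κ′ u : MKer 4 F`: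
`bubbleTableA A S κ′ λ′ u u′ := −½ · bubble A (S κ′ u) (S λ′ u′)`.  A DEFINITION; asserts nothing.  (`A := Ga n a` gives
`DressedBubbleTable.bubbleTable n a`.) -/
def bubbleTableA (A : MKer 4 F) (S : Fin 4 → Site 4 → MKer 4 F) : EKer₂ 4 :=
  fun κ' l' u u' => -(1 / 2 : ℝ) * bubble A (S κ' u) (S l' u')

/-- [our object] Unfolding. -/
theorem bubbleTableA_apply (A : MKer 4 F) (S : Fin 4 → Site 4 → MKer 4 F) (κ' l' : Fin 4) (u u' : Site 4) :
    bubbleTableA A S κ' l' u u' = -(1 / 2 : ℝ) * bubble A (S κ' u) (S l' u') := rfl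

variable (n : ℕ) [NeZero n] (A : MKer 4 F)

omit [Fintype F] [NeZero n] in
/-- [folklore] Re-bracketing a block-covariance hypothesis: `shiftK (−(n•t)) A = A` for all `t` ⇒ `shiftK (n•t) A = A` for all `t`. -/
theorem shiftK_smul_of_neg (hA : ∀ t : Site 4, shiftK (-((n : ℤ) • t)) A = A) (t : Site 4) : shiftK ((n : ℤ) • t) A = A := by
  have h := hA (-t)
  rwa [smul_neg, neg_neg] at h

omit [NeZero n] in
/-- [folklore] **BLOCK PERIODICITY** of every entry of the bubble table, for a BLOCK-COVARIANT leg (`shiftK (−n•t) A = A`) and a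
fine-translation-covariant stencil family (`S κ′ (u + v) = shiftK (−v) (S κ′ u)`), by `bubble_shiftK`. -/
theorem isBlockPeriodic_bubbleTableA (hA : ∀ t : Site 4, shiftK (-((n : ℤ) • t)) A = A) {S : Fin 4 → Site 4 → MKer 4 F}
    (hS : ∀ (κ' : Fin 4) (u v : Site 4), S κ' (u + v) = shiftK (-v) (S κ' u)) (κ' l' : Fin 4) :
    IsBlockPeriodic n (bubbleTableA A S κ' l') := by
  intro t s s'
  simp only [bubbleTableA_apply]
  rw [hS κ' s ((n : ℤ) • t), hS l' s' ((n : ℤ) • t)]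
  conv_lhs => rw [← hA t]
  rw [bubble_shiftK]

/-- [folklore] **THE BUBBLE IS SYMMETRIC IN ITS TWO VERTICES** for a spread leg and localised vertices (any `D`, any fibre; cyclicity of
the trace, `TameKernelCalculus.tr_comp_comm_loc`). -/
theorem bubble_comm {D : ℕ} {A V W : MKer D F} (hA : Spr A) (hV : Loc V) (hW : Loc W) : bubble A V W = bubble A W V := by
  unfold ExpKernelCalculus.bubble
  exact tr_comp_comm_loc (hA.comp_loc hV) (hA.comp_loc hW).tame

/-- [folklore] **MATRIX SYMMETRY OF THE BUBBLE TABLE**: `P κ′ λ′ u u′ = P λ′ κ′ u′ u`. -/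
theorem bubbleTableA_transpose {S : Fin 4 → Site 4 → MKer 4 F} (hA : Spr A) {Cs δ : ℝ} (hS : ∀ κ' u, BiLoc (S κ' u) u u Cs δ)
    (hδ : 0 < δ) (κ' l' : Fin 4) (u u' : Site 4) : bubbleTableA A S κ' l' u u' = bubbleTableA A S l' κ' u' u := by
  simp only [bubbleTableA_apply]
  rw [bubble_comm hA ⟨u, u, Cs, δ, hδ, hS κ' u⟩ ⟨u', u', Cs, δ, hδ, hS l' u'⟩]

/-- [folklore] **EXPONENTIAL LOCALISATION OF THE BUBBLE TABLE IN THE SEPARATION**: `|P κ′λ′ (b + t) b| ≤ C′ e^{−δ′|t|₁}` with ONE pair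
`(C′, δ′)` for all entries and base points. -/
theorem exists_decay_bubbleTableA {S : Fin 4 → Site 4 → MKer 4 F} (hA : Spr A) {Cs δ : ℝ} (hS : ∀ κ' u, BiLoc (S κ' u) u u Cs δ)
    (hδ : 0 < δ) : ∃ C' δ' : ℝ, 0 < δ' ∧ ∀ (κ' l' : Fin 4) (b : Site 4), Decay510 (baseKer (bubbleTableA A S κ' l') b) C' δ' := by
  obtain ⟨CA, δA, hδA, hAd⟩ := hA
  set m : ℝ := min δA δ with hm
  have hm0 : 0 < m := lt_min hδA hδ
  have hm2 : 0 < m / 2 := half_pos hm0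
  have hAd' : Decays A (|CA|) m := decays_of_le hAd (min_le_left _ _)
  have hS' : ∀ κ' u, BiLoc (S κ' u) u u (|Cs|) m := fun κ' u => biLoc_of_le (hS κ' u) (min_le_right _ _)
  set C1 : ℝ := (Fintype.card F : ℝ) * (|CA| * |Cs|) * Zl 4 (m - m / 2)
  set C3 : ℝ := (Fintype.card F : ℝ) * (C1 * C1) * Zl 4 (m / 2 / 2)
  have hC10 : 0 ≤ C1 := mul_nonneg (by positivity) (Zl_nonneg (by linarith))
  have hC30 : 0 ≤ C3 := mul_nonneg (mul_nonneg (Nat.cast_nonneg _) (mul_nonneg hC10 hC10)) (Zl_nonneg (by linarith))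
  refine ⟨1 / 2 * ((Fintype.card F : ℝ) * C3 * Zl 4 (m / 2 / 2)), m / 2 / 2, by positivity, fun κ' l' b t => ?_⟩
  have h1 : BiLoc (comp A (S κ' (b + t))) (b + t) (b + t) C1 (m / 2) :=
    biLoc_comp_decays hAd' (hS' κ' (b + t)) hm2.le (by linarith)
  have h2 : BiLoc (comp A (S l' b)) b b C1 (m / 2) := biLoc_comp_decays hAd' (hS' l' b) hm2.le (by linarith)
  have h3 : BiLoc (comp (comp A (S κ' (b + t))) (comp A (S l' b))) (b + t) b C3 (m / 2) :=
    biLoc_const_mono (biLoc_comp_biLoc h1 h2 hm2)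
      (mul_le_of_le_one_right hC30 (Real.exp_le_one_iff.2 (by nlinarith [l1_nonneg (b + t - b)])))
  have h4 := abs_tr_le h3 hm2
  rw [add_sub_cancel_left] at h4
  simp only [baseKer, bubbleTableA_apply, ExpKernelCalculus.bubble, abs_mul]
  rw [show |(-(1 / 2 : ℝ))| = 1 / 2 by norm_num, mul_assoc]
  exact mul_le_mul_of_nonneg_left h4 (by norm_num)

/-- [folklore] Hence every base-point kernel of every entry has an absolutely summable second moment. -/
theorem absMoment₂_baseKer_bubbleTableA {S : Fin 4 → Site 4 → MKer 4 F} (hA : Spr A) {Cs δ : ℝ}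
    (hS : ∀ κ' u, BiLoc (S κ' u) u u Cs δ) (hδ : 0 < δ) (κ' l' : Fin 4) (b : Site 4) :
    AbsMoment₂ (baseKer (bubbleTableA A S κ' l') b) := by
  obtain ⟨C', δ', hδ', h⟩ := exists_decay_bubbleTableA A hA hS hδ
  exact absMoment₂_of_decay510 hδ' (h κ' l' b)

/-! ## §2 The bridge: the bubble of `ℋ`-dressed vertices is the `ℋ`-sandwich of the bubble table -/

omit [Fintype F] in
/-- [folklore] `vertexRedF n S μ y` as a finite sum of weighted superpositions (as a kernel). -/
theorem vertexRedF_eq_sum_wsum (S : Fin 4 → Site 4 → MKer 4 F) (μ : Fin 4) (y : Site 4) :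
    vertexRedF n S μ y = ∑ κ' : Fin 4, wsum (fun u => wH (N := n) (d := 3) κ' μ (u - (n : ℤ) • y)) (S κ') := by
  funext x z a' b
  simp only [vertexRedF, Finset.sum_apply]

omit [Fintype F] in
/-- [folklore] Each summand of `vertexRedF` is a localised kernel. -/
theorem loc_wsum_wH {S : Fin 4 → Site 4 → MKer 4 F} {Cs δ : ℝ} (hS : ∀ κ' u, BiLoc (S κ' u) u u Cs δ) (hδ : 0 < δ)
    (κ' μ : Fin 4) (y : Site 4) : Loc (wsum (fun u => wH (N := n) (d := 3) κ' μ (u - (n : ℤ) • y)) (S κ')) := by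
  obtain ⟨Cw, δw, hCw, hδw, hw⟩ := exists_expWeight_wH n
  have hm : 0 < min δw δ := lt_min hδw hδ
  exact loc_wsum (fun u => expWeight_of_le (hw κ' μ y) hCw (min_le_left _ _) u) hCw
    (fun u => biLoc_of_le (hS κ' u) (min_le_right _ _)) hm

variable [Nonempty F]

/-- [folklore] **THE BUBBLE OF TWO `ℋ`-DRESSED VERTICES IS THE `ℋ ⊗ ℋ`-SUPERPOSITION OF THE STENCIL BUBBLES** (generic leg):
`bubble A (vertexRedF S μ y) (vertexRedF S ν y′) = Σ_{κ′} Σ_{λ′} Σ'_{(u,u′)} ℋ_{(κ′,u),(μ,y)} ℋ_{(λ′,u′),(ν,y′)} · bubble A (S κ′ u) (S λ′ u′)`. -/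
theorem bubble_vertexRedF {S : Fin 4 → Site 4 → MKer 4 F} (hA : Spr A) {Cs δ : ℝ} (hS : ∀ κ' u, BiLoc (S κ' u) u u Cs δ)
    (hδ : 0 < δ) (μ ν : Fin 4) (y y' : Site 4) :
    bubble A (vertexRedF n S μ y) (vertexRedF n S ν y')
      = ∑ κ' : Fin 4, ∑ l' : Fin 4, ∑' q : Site 4 × Site 4,
          wH (N := n) (d := 3) κ' μ (q.1 - (n : ℤ) • y) * wH (N := n) (d := 3) l' ν (q.2 - (n : ℤ) • y')
            * bubble A (S κ' q.1) (S l' q.2) := by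
  obtain ⟨Cw, δw, hCw, hδw, hw⟩ := exists_expWeight_wH n
  rw [vertexRedF_eq_sum_wsum n S μ y, vertexRedF_eq_sum_wsum n S ν y',
    bubble_finset_sum_left _ hA (fun κ' => loc_wsum_wH n hS hδ κ' μ y) (loc_finset_sum _ fun l' => loc_wsum_wH n hS hδ l' ν y')]
  refine Finset.sum_congr rfl fun κ' _ => ?_
  rw [bubble_finset_sum_right _ hA (loc_wsum_wH n hS hδ κ' μ y) (fun l' => loc_wsum_wH n hS hδ l' ν y')]
  refine Finset.sum_congr rfl fun l' _ => ?_
  exact bubble_wsum_wsum hA (hw κ' μ y) hδw (hw l' ν y') hCw hδw (fun u => hS κ' u) (fun u => hS l' u) hδ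

/-- [folklore] **THE BUBBLE PART OF `TOfLeg` IS K-R5's SANDWICH** (generic leg): with the base point `0` on the left,
`−½ · bubble A (vertexRedF S μ 0) (vertexRedF S ν z) = dressedEntryP (wK n) (bubbleTableA A S) (n • (−z)) μ ν` — reindex the right fine
point by `u′ = x + n•z` and use block periodicity of the table. -/
theorem bubblePartA_eq_dressedEntryP (hA : Spr A) (hAcov : ∀ t : Site 4, shiftK (-((n : ℤ) • t)) A = A)
    {S : Fin 4 → Site 4 → MKer 4 F} {Cs δ : ℝ} (hS : ∀ κ' u, BiLoc (S κ' u) u u Cs δ) (hδ : 0 < δ)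
    (hScov : ∀ (κ' : Fin 4) (u v : Site 4), S κ' (u + v) = shiftK (-v) (S κ' u)) (μ ν : Fin 4) (z : Site 4) :
    -(1 / 2 : ℝ) * bubble A (vertexRedF n S μ 0) (vertexRedF n S ν z)
      = dressedEntryP (wK n) (bubbleTableA A S) ((n : ℤ) • (-z)) μ ν := by
  rw [bubble_vertexRedF n A hA hS hδ μ ν 0 z, Finset.mul_sum]
  simp only [dressedEntryP, dressedSumP]
  refine Finset.sum_congr rfl fun κ' _ => ?_
  rw [Finset.mul_sum]
  refine Finset.sum_congr rfl fun l' _ => ?_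
  rw [← tsum_mul_left]
  rw [← (Equiv.prodCongr (Equiv.refl (Site 4)) (Equiv.addRight ((n : ℤ) • z))).tsum_eq]
  refine tsum_congr fun q => ?_
  obtain ⟨u, x⟩ := q
  simp only [Equiv.prodCongr_apply, Prod.map_apply, Equiv.refl_apply, Equiv.coe_addRight, smul_zero, sub_zero,
    add_sub_cancel_right, bubbleTableA_apply]
  have hper := isBlockPeriodic_bubbleTableA n A hAcov hScov κ' l' (-z) u (x + (n : ℤ) • z)
  rw [bubbleTableA_apply, bubbleTableA_apply, smul_neg, show x + (n : ℤ) • z + -((n : ℤ) • z) = x by abel] at hper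
  rw [show (n : ℤ) • -z + u = u + -((n : ℤ) • z) by rw [smul_neg]; abel, hper]
  simp only [wK]
  ring

/-! ## §3 The fine tadpole table over a generic leg and the `ℋ ⊗ ℋ` exchange for the typer's dressed table -/

omit [Nonempty F] in
/-- [our object] **THE FINE TADPOLE TABLE OVER THE LEG `A`** of a second-order fine table family `Wf κ′ u λ′ u′ : MKer 4 F`:
`tadpoleTableA A Wf κ′ λ′ u u′ := ½ · tadpole A (Wf κ′ u λ′ u′)`.  A DEFINITION; asserts nothing.  (`A := Ga n a` gives
`DressedTadpoleTable.tadpoleTable n a`.) -/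
def tadpoleTableA (A : MKer 4 F) (Wf : Fin 4 → Site 4 → Fin 4 → Site 4 → MKer 4 F) : EKer₂ 4 :=
  fun κ' l' u u' => (1 / 2 : ℝ) * tadpole A (Wf κ' u l' u')

omit [Nonempty F] in
/-- [our object] Unfolding. -/
theorem tadpoleTableA_apply (Wf : Fin 4 → Site 4 → Fin 4 → Site 4 → MKer 4 F) (κ' l' : Fin 4) (u u' : Site 4) :
    tadpoleTableA A Wf κ' l' u u' = (1 / 2 : ℝ) * tadpole A (Wf κ' u l' u') := rfl

variable {Wf : Fin 4 → Site 4 → Fin 4 → Site 4 → MKer 4 F} {C2 δ : ℝ}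

omit [Nonempty F] [NeZero n] in
/-- [folklore] BLOCK PERIODICITY of the tadpole table: block-covariant leg + jointly fine-translation-covariant table family
(`Wf κ′ (u+v) λ′ (u′+v) = shiftK (−v) (Wf κ′ u λ′ u′)`), by `tadpole_shiftK`. -/
theorem isBlockPeriodic_tadpoleTableA (hAcov : ∀ t : Site 4, shiftK (-((n : ℤ) • t)) A = A)
    (hWcov : ∀ (κ' : Fin 4) (u : Site 4) (l' : Fin 4) (u' v : Site 4), Wf κ' (u + v) l' (u' + v) = shiftK (-v) (Wf κ' u l' u'))
    (κ' l' : Fin 4) : IsBlockPeriodic n (tadpoleTableA A Wf κ' l') := by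
  intro t s s'
  simp only [tadpoleTableA_apply]
  rw [hWcov κ' s l' s' ((n : ℤ) • t)]
  conv_lhs => rw [← hAcov t]
  rw [tadpole_shiftK]

/-- [folklore] EXPONENTIAL LOCALISATION of the tadpole table in the separation, one `(C′, δ′)` for all entries and base points. -/
theorem exists_decay_tadpoleTableA (hA : Spr A) (hW : ∀ κ' u l' u', BiLoc (Wf κ' u l' u') u u' C2 δ) (hδ : 0 < δ) :
    ∃ C' δ' : ℝ, 0 < δ' ∧ ∀ (κ' l' : Fin 4) (b : Site 4), Decay510 (baseKer (tadpoleTableA A Wf κ' l') b) C' δ' := by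
  obtain ⟨CA, δA, hδA, hAd⟩ := hA
  set m : ℝ := min δA δ with hm
  have hm0 : 0 < m := lt_min hδA hδ
  have hm2 : 0 < m / 2 := half_pos hm0
  have hAd' : Decays A (|CA|) m := decays_of_le hAd (min_le_left _ _)
  have hW' : ∀ κ' u l' u', BiLoc (Wf κ' u l' u') u u' (|C2|) m := fun κ' u l' u' => biLoc_of_le (hW κ' u l' u') (min_le_right _ _)
  set C1 : ℝ := (Fintype.card F : ℝ) * (|CA| * |C2|) * Zl 4 (m - m / 2)
  have hC10 : 0 ≤ C1 := mul_nonneg (by positivity) (Zl_nonneg (by linarith))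
  refine ⟨1 / 2 * ((Fintype.card F : ℝ) * C1 * Zl 4 (m / 2 / 2)), m / 2 / 2, by positivity, fun κ' l' b t => ?_⟩
  have h1 : BiLoc (comp A (Wf κ' (b + t) l' b)) (b + t) b C1 (m / 2) :=
    biLoc_comp_decays hAd' (hW' κ' (b + t) l' b) hm2.le (by linarith)
  have h4 := abs_tr_le h1 hm2
  rw [add_sub_cancel_left] at h4
  simp only [baseKer, tadpoleTableA_apply, ExpKernelCalculus.tadpole, abs_mul]
  rw [show |(1 / 2 : ℝ)| = 1 / 2 by norm_num, mul_assoc]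
  exact mul_le_mul_of_nonneg_left h4 (by norm_num)

/-- [folklore] Hence absolutely summable second moments of every base-point kernel of the tadpole table. -/
theorem absMoment₂_baseKer_tadpoleTableA (hA : Spr A) (hW : ∀ κ' u l' u', BiLoc (Wf κ' u l' u') u u' C2 δ) (hδ : 0 < δ)
    (κ' l' : Fin 4) (b : Site 4) : AbsMoment₂ (baseKer (tadpoleTableA A Wf κ' l') b) := by
  obtain ⟨C', δ', hδ', h⟩ := exists_decay_tadpoleTableA A hA hW hδ
  exact absMoment₂_of_decay510 hδ' (h κ' l' b)

omit [Fintype F] [Nonempty F] in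
/-- [folklore] The typer's `tableRedF` as a double finite sum of superpositions (as a kernel). -/
theorem tableRedF_eq_sum_wsum (Wf : Fin 4 → Site 4 → Fin 4 → Site 4 → MKer 4 F) (μ : Fin 4) (y : Site 4) (ν : Fin 4)
    (y' : Site 4) :
    tableRedF n Wf μ y ν y' = ∑ κ' : Fin 4, ∑ l' : Fin 4, wsum (fun u => wH (N := n) (d := 3) κ' μ (u - (n : ℤ) • y))
      (fun u => wsum (fun u' => wH (N := n) (d := 3) l' ν (u' - (n : ℤ) • y')) (Wf κ' u l')) := by
  funext x z a' b
  simp only [tableRedF, Finset.sum_apply]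

omit [Fintype F] [Nonempty F] in
/-- [folklore] Each `(κ′, λ′)` summand of `tableRedF` is a localised kernel (at `(n•y, n•y′)`): inner superposition by
`DressedTadpoleTable.biLoc_wsum_snd`, outer by `biLoc_wsum_fst`. -/
theorem loc_summand_tableRedF (hW : ∀ κ' u l' u', BiLoc (Wf κ' u l' u') u u' C2 δ) (hδ : 0 < δ) (κ' l' μ ν : Fin 4)
    (y y' : Site 4) :
    Loc (wsum (fun u => wH (N := n) (d := 3) κ' μ (u - (n : ℤ) • y))
      (fun u => wsum (fun u' => wH (N := n) (d := 3) l' ν (u' - (n : ℤ) • y')) (Wf κ' u l'))) := by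
  obtain ⟨Cw, δw, hCw, hδw, hw⟩ := exists_expWeight_wH n
  have hm : 0 < min δw δ := lt_min hδw hδ
  have hin : ∀ u, BiLoc (wsum (fun u' => wH (N := n) (d := 3) l' ν (u' - (n : ℤ) • y')) (Wf κ' u l')) u ((n : ℤ) • y')
      (Cw * |C2| * Zl 4 (min δw δ / 2)) (min δw δ / 2) := fun u =>
    biLoc_wsum_snd (fun u' => expWeight_of_le (hw l' ν y') hCw (min_le_left _ _) u')
      (fun u' => biLoc_of_le (hW κ' u l' u') (min_le_right _ _)) hm hCw
  have hm' : 0 < min δw (min δw δ / 2) := lt_min hδw (half_pos hm)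
  exact ⟨(n : ℤ) • y, (n : ℤ) • y', _, _, half_pos hm',
    biLoc_wsum_fst (fun u => expWeight_of_le (hw κ' μ y) hCw (min_le_left _ _) u)
      (fun u => biLoc_of_le (hin u) (min_le_right _ _)) hm' hCw⟩

/-- [folklore] **THE TADPOLE OF THE TYPER'S DRESSED TABLE IS THE `ℋ ⊗ ℋ`-SUPERPOSITION OF THE FINE TADPOLES** (generic leg and fibre):
`tadpole A (tableRedF n Wf μ y ν y′) = Σ_{κ′λ′} Σ'_{(u,u′)} ℋ_{(κ′,u),(μ,y)} ℋ_{(λ′,u′),(ν,y′)} · tadpole A (Wf κ′ u λ′ u′)` — finite additivity of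
the tadpole over localised summands, then `DressedTadpoleTable.tadpole_wsum_wsum` per `(κ′, λ′)`; no finite-sum / series exchange is
needed in `tableRedF`'s summation order. -/
theorem tadpole_tableRedF (hA : Spr A) (hW : ∀ κ' u l' u', BiLoc (Wf κ' u l' u') u u' C2 δ) (hδ : 0 < δ) (μ : Fin 4) (y : Site 4)
    (ν : Fin 4) (y' : Site 4) :
    tadpole A (tableRedF n Wf μ y ν y')
      = ∑ κ' : Fin 4, ∑ l' : Fin 4, ∑' q : Site 4 × Site 4,
          wH (N := n) (d := 3) κ' μ (q.1 - (n : ℤ) • y) * wH (N := n) (d := 3) l' ν (q.2 - (n : ℤ) • y')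
            * tadpole A (Wf κ' q.1 l' q.2) := by
  obtain ⟨Cw, δw, hCw, hδw, hw⟩ := exists_expWeight_wH n
  rw [tableRedF_eq_sum_wsum,
    tadpole_finset_sum _ hA (fun κ' => loc_finset_sum _ fun l' => loc_summand_tableRedF n hW hδ κ' l' μ ν y y')]
  refine Finset.sum_congr rfl fun κ' _ => ?_
  rw [tadpole_finset_sum _ hA (fun l' => loc_summand_tableRedF n hW hδ κ' l' μ ν y y')]
  refine Finset.sum_congr rfl fun l' _ => ?_
  exact tadpole_wsum_wsum hA (hw κ' μ y) hδw (hw l' ν y') hCw hδw (fun u u' => hW κ' u l' u') hδ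

/-- [folklore] **THE TADPOLE PART OF `TOfLeg n A S (tableRedF n Wf)` IS THE SANDWICH OF THE TADPOLE TABLE**:
`½·tadpole A (tableRedF n Wf μ 0 ν z) = dressedEntryP (wK n) (tadpoleTableA A Wf) (n•(−z)) μ ν`. -/
theorem tadpolePartA_eq_dressedEntryP (hA : Spr A) (hAcov : ∀ t : Site 4, shiftK (-((n : ℤ) • t)) A = A)
    (hW : ∀ κ' u l' u', BiLoc (Wf κ' u l' u') u u' C2 δ) (hδ : 0 < δ)
    (hWcov : ∀ (κ' : Fin 4) (u : Site 4) (l' : Fin 4) (u' v : Site 4), Wf κ' (u + v) l' (u' + v) = shiftK (-v) (Wf κ' u l' u'))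
    (μ ν : Fin 4) (z : Site 4) :
    (1 / 2 : ℝ) * tadpole A (tableRedF n Wf μ 0 ν z) = dressedEntryP (wK n) (tadpoleTableA A Wf) ((n : ℤ) • (-z)) μ ν := by
  rw [tadpole_tableRedF n A hA hW hδ μ 0 ν z, Finset.mul_sum]
  simp only [dressedEntryP, dressedSumP]
  refine Finset.sum_congr rfl fun κ' _ => ?_
  rw [Finset.mul_sum]
  refine Finset.sum_congr rfl fun l' _ => ?_
  rw [← tsum_mul_left]
  rw [← (Equiv.prodCongr (Equiv.refl (Site 4)) (Equiv.addRight ((n : ℤ) • z))).tsum_eq]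
  refine tsum_congr fun q => ?_
  obtain ⟨u, x⟩ := q
  simp only [Equiv.prodCongr_apply, Prod.map_apply, Equiv.refl_apply, Equiv.coe_addRight, smul_zero, sub_zero,
    add_sub_cancel_right, tadpoleTableA_apply]
  have hper := isBlockPeriodic_tadpoleTableA n A hAcov hWcov κ' l' (-z) u (x + (n : ℤ) • z)
  rw [tadpoleTableA_apply, tadpoleTableA_apply, smul_neg, show x + (n : ℤ) • z + -((n : ℤ) • z) = x by abel] at hper
  rw [show (n : ℤ) • -z + u = u + -((n : ℤ) • z) by rw [smul_neg]; abel, hper]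
  simp only [wK]
  ring

end Summit.QuantumFields.BalabanUV.Beta.D1BFx.DressedTablesLeg

end
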